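/-
Copyright: the b2b-balaban T⁴-continuum CRUX team, row NE7b OWNER lineage `t4-ne7b-p1` (gen 125). Project licence.
-/
import Summits.QuantumFields.BalabanUV.T4Continuum.Spine.NE7b.SupZdPerturbedSymmetric
import Summits.QuantumFields.BalabanUV.T4Continuum.Spine.NE7b.SupZdKernelForm

/-!
# THE PERTURBED NEXT-SCALE ACTION ON `ℤ^d` IS STRICTLY CONVEX WITH A BOUNDED HESSIAN: with (232)'s objects and merged constants (all
# clauses re-exported; `K` symmetric of the class) and ONE more smallness condition — the coarse perturbation below half the coarse floor,
# `D_E·K_μ ≤ γ_Q∕2` (`D_E = 4C_ΨK·C_ΨK·εe^{μd}K_{γ−μ}` (222) (A)'s bound on `T_K − T`, `γ_Q = 1∕(36^d(4d + a + Λ))` [B6]'s floor (186)) — the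
# perturbed coarse operator `T_K` has the FLOOR `γ_Q∕2` and the form bound `Λ_T + γ_Q∕2` on finitely supported coarse functions, and its
# inverse `N_K` satisfies, for every finitely supported `k`: `T_K(N_Kk) = k`, `‖N_Kk‖₂ ≤ (γ_Q∕2)⁻¹‖k‖₂`, `(γ_Q∕2)‖N_Kk‖₂² ≤ ⟨k, N_Kk⟩ ≤
# (γ_Q∕2)⁻¹‖k‖₂²`, `⟨k, N_Kk⟩ ≥ ((γ_Q∕2)∕(Λ_T + γ_Q∕2)²)‖k‖₂²` — (205)'s four bounds for the `H + K` column, mesh-free, every `V : ℤ^d → [−λ, Λ]`,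
# `d ≥ 3`: the convexity class the road iterates SURVIVES a small symmetric nonlocal perturbation of the Hessian in infinite volume
# (row NE7b, node U5c; (186)∕(191)∕(232)∕(233) BY NAME; [folklore])

Cell `pub-balaban`, sub-cell `t4`, spine estimate NE7b (`T4WeightBudget.RelWeightBound`; the cell's OWN estimate — NOT PRINTED in
[Bałaban 1983–89], NOT PROVED).  Crux-route work under `Spine/NE7b/` by the row OWNER (`t4-ne7b-p1` gen 125, file (234)) under FREEZE
(0)'s crux-prover clause; NOTHING of Bałaban's is named as a Lean object, valued or asserted; no `T4Continuum/Support` leaf typed; no `def`,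
no notation (`T_K(b,c) = (n+1)^{−d}Σ_{q ∈ B n b}Ψ^K_c(q)` and `N_Kk = Σ_{c ∈ S}N_K(·,c)k(c)` WRITTEN OUT); zero `sorry`.  Imports (BY NAME): the
OWNER's (232) `…SupZdPerturbedSymmetric` (`zd_perturbed_symmetric`; through it (222) `K_pos`, (191) `zd_coarse_form_bounded`, `kernel_form_sq_le`,
(186) `zd_coarse_floor`, (27) `mem_B`, `sum_B_const`), (233) `…SupZdKernelForm` (`decaying_inverse_form`), Mathlib's `abs_le_of_sq_le_sq`,
`Real.sqrt` algebra.

WHY (located).  The road iterates strictly convex actions with bounded Hessians; after a step the next-scale Hessian is `(n+1)^dT⁻¹`, and on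
`ℤ^d` (205) showed `M = T_∞⁻¹` keeps floor and ceiling.  The `H + K` column ((216)–(232)) produced `T_K`, `N_K = T_K⁻¹` with decay, Lipschitz
bounds and symmetry, but no `ℓ²` statement — the quadratic form `(n+1)^d⟨k, N_Kk⟩∕2` of the perturbed next-scale action was not yet known to be
positive.  The floor of `T_K` is PERTURBATIVE: `⟨g, T_Kg⟩ = ⟨g, Tg⟩ + ⟨g, (T_K − T)g⟩ ≥ (γ_Q − D_EK_μ)Σg²` by (186)'s floor and the Schur test
(191) on `|T_K − T| ≤ D_Ee^{−μ|b−c|₁}` ((222) (A)); the form bound adds the same way; and (233)'s `decaying_inverse_form` — written for exactly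
this purpose, since `N_K` was built by a Neumann series and not by sections — turns floor + form bound + `T_KN_K = 1` + decay of `N_K` into the
four bounds.  `K` symmetric ((232)) so that `T_K`, `N_K` are symmetric forms, as Hessians are.

WHAT IS PROVED ([folklore]): §1 `coarse_entry_le` (block means inherit block-profile bounds), `sq_add_le` (adding two Schur-type form bounds);
§2 **`zd_perturbed_coarse_form`** (THE END: `∃ C₀ C_P δ₀ c₁ δ₁ Λ_T > 0` from `(d, a, λ, Λ)`: for ALL data as in (232) plus `D_EK_μ ≤ γ_Q∕2`:
`∃ Ψ Ψ^K M N` with ALL clauses (A)–(D) of (232) AND (E): `|T_K(b,c)| ≤ 2C_ΨKe^{−μ|b−c|₁}`; floor `γ_Q∕2`; form bound `(Λ_T + γ_Q∕2)²`; and for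
every `k` vanishing off a finite `S`: `T_K(N_Kk) = k`, `Σ′(N_Kk)²` converges and dominates the finite sums, (i)–(iv) as displayed); §3 toy.

HONEST (what this is NOT).  Form bounds on finitely supported `k` (no `ℓ²` operator packaging); the floor is halved and needs the extra
smallness (not (166)'s non-perturbative torus floor `1∕(36^d(4d + a + Λ + εK_γ))`, whose `ℤ^d` twin waits for the torus → `ℤ^d` limit of the
`H + K` tower); `d ≥ 3`; scalar skeleton ((A3), NC-NE7b-α UNRULED); nothing of the covariant propagators of [B4]–[B6]; [B6] (2.76) is the
printed MODEL of the floor — locator only; nothing of Bałaban's asserted.  BY-NAME EFFECT ON THE WALL: NONE.  NE7b NOT PRINTED ∕ NOT PROVED;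
spine PROVED 0∕9; rung (B)+1 — the programme's measures remain FINITE-torus statements; NOT the mass gap, NOT Clay.  HONEST DEPENDENCY:
continuum YM on T⁴ ⇐ BetaPertH ∧ nine spine estimates (0∕9 proved); BetaPertH ⇐ (D1) ∧ (D4) ∧ CAP+tail; G-an2-4 gates asym, D1 and NE2∕3∕4.
-/

set_option autoImplicit false

noncomputable section

namespace Summit.QuantumFields.BalabanUV.T4Continuum.NE7b.SupZdPerturbedCoarseForm

open Real Filter Topology
open scoped ENNReal
open Literature.MathematicalPhysics.QuantumFieldTheory.Balaban1983to89
open B6QGQLower276 (X e blk B mem_B sum_B_const)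
open SupZdCoarseOperator (zd_coarse_floor)
open SupZdCoarseForm (kernel_form_sq_le zd_coarse_form_bounded)
open SupZdPerturbedColumn (K_pos)
open SupZdPerturbedSymmetric (zd_perturbed_symmetric)
open SupZdKernelForm (decaying_inverse_form)

variable {d : ℕ}

/-! ## §1. Two bookkeeping lemmas -/

/-- **BLOCK MEANS INHERIT BLOCK PROFILES**: `|Φ_c(p)| ≤ A·e^{−μ|blk n p − c|₁}` ⟹ `|(n+1)^{−d}Σ_{q ∈ B n b}Φ_c(q)| ≤ A·e^{−μ|b − c|₁}`. [folklore] -/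
theorem coarse_entry_le (n : ℕ) {A μ : ℝ} (Φ : X d → X d → ℝ) (c : X d)
    (hΦ : ∀ p, |Φ c p| ≤ A * exp (-(μ * ∑ i, (((blk n p i - c i).natAbs : ℕ) : ℝ)))) (b : X d) :
    |(((n : ℝ) + 1) ^ d)⁻¹ * ∑ q ∈ B n b, Φ c q| ≤ A * exp (-(μ * ∑ i, (((b i - c i).natAbs : ℕ) : ℝ))) := by
  have hvol : (0 : ℝ) < ((n : ℝ) + 1) ^ d := by positivity
  rw [abs_mul, abs_of_pos (inv_pos.2 hvol)]
  have h : ∑ q ∈ B n b, |Φ c q| ≤ ∑ _q ∈ B n b, A * exp (-(μ * ∑ i, (((b i - c i).natAbs : ℕ) : ℝ))) :=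
    Finset.sum_le_sum fun q hq => by have h := hΦ q; rwa [mem_B.1 hq] at h
  rw [sum_B_const] at h
  calc (((n : ℝ) + 1) ^ d)⁻¹ * |∑ q ∈ B n b, Φ c q| ≤ (((n : ℝ) + 1) ^ d)⁻¹ * ∑ q ∈ B n b, |Φ c q| :=
        mul_le_mul_of_nonneg_left (Finset.abs_sum_le_sum_abs _ _) (inv_nonneg.2 hvol.le)
    _ ≤ (((n : ℝ) + 1) ^ d)⁻¹ * (((n : ℝ) + 1) ^ d * (A * exp (-(μ * ∑ i, (((b i - c i).natAbs : ℕ) : ℝ))))) :=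
        mul_le_mul_of_nonneg_left h (inv_nonneg.2 hvol.le)
    _ = _ := by field_simp

/-- **ADDING TWO FORM BOUNDS**: `a² ≤ X²c`, `b² ≤ Y²c` (`X, Y, c ≥ 0`) ⟹ `(a + b)² ≤ (X + Y)²c`. [folklore] -/
theorem sq_add_le {a b X Y c : ℝ} (hX : 0 ≤ X) (hY : 0 ≤ Y) (hc : 0 ≤ c) (ha : a ^ 2 ≤ X ^ 2 * c) (hb : b ^ 2 ≤ Y ^ 2 * c) :
    (a + b) ^ 2 ≤ (X + Y) ^ 2 * c := by
  have h1 : |a| ≤ X * Real.sqrt c :=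
    abs_le_of_sq_le_sq (by rw [mul_pow, Real.sq_sqrt hc]; exact ha) (mul_nonneg hX (Real.sqrt_nonneg c))
  have h2 : |b| ≤ Y * Real.sqrt c :=
    abs_le_of_sq_le_sq (by rw [mul_pow, Real.sq_sqrt hc]; exact hb) (mul_nonneg hY (Real.sqrt_nonneg c))
  have h3 : |a + b| ≤ (X + Y) * Real.sqrt c := (abs_add_le a b).trans (by linarith)
  calc (a + b) ^ 2 = |a + b| ^ 2 := (sq_abs _).symm
    _ ≤ ((X + Y) * Real.sqrt c) ^ 2 := pow_le_pow_left₀ (abs_nonneg _) h3 2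
    _ = (X + Y) ^ 2 * c := by rw [mul_pow, Real.sq_sqrt hc]

/-! ## §2. THE END: the perturbed next-scale action is strictly convex with a bounded Hessian on `ℓ²(ℤ^d)` -/

/-- **HEADLINE — THE `ℓ²` THEORY OF `T_K` AND `N_K = T_K⁻¹`**: `d ≥ 3`, `a > 0`, `λ < min(2,a)`, `Λ ≥ 0` ⟹ `∃ C₀ C_P δ₀ c₁ δ₁ Λ_T > 0` (from
`(d, a, λ, Λ)` ONLY) such that, with `γ_Q = 1∕(36^d(4d + a + Λ))`, for ALL `n`, `V : ℤ^d → [−λ, Λ]`, rates and sizes as in (232), the three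
smallness conditions of (222) AND `D_EK_μ ≤ γ_Q∕2`, and every SYMMETRIC kernel `|K(p,q)| ≤ εe^{−γ|p−q|₁}`: the objects `Ψ, Ψ^K, M, N` of (232)
exist with ALL their clauses (A)–(D) AND (E): `|T_K(b,c)| ≤ 2C_ΨKe^{−μ|b−c|₁}`; the floor `(γ_Q∕2)Σ_Sg² ≤ ⟨g, T_Kg⟩_S` and the bound `⟨h, T_Kg⟩_S²
≤ (Λ_T + γ_Q∕2)²(Σ_Sh²)(Σ_Sg²)` on finite supports; and for every `k` vanishing off a finite `S`: `T_K(N_Kk) = k`, `Σ′(N_Kk)² < ∞` dominating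
every `Σ_F(N_Kk)²`, (i) `Σ′(N_Kk)² ≤ (γ_Q∕2)⁻²Σ_Sk²`, (ii) `(γ_Q∕2)Σ′(N_Kk)² ≤ ⟨k, N_Kk⟩`, (iii) `⟨k, N_Kk⟩ ≤ (γ_Q∕2)⁻¹Σ_Sk²`, (iv)
`((γ_Q∕2)∕(Λ_T + γ_Q∕2)²)Σ_Sk² ≤ ⟨k, N_Kk⟩` — the perturbed next-scale action `(n+1)^d⟨k, N_Kk⟩∕2` is STRICTLY CONVEX with a BOUNDED Hessian.
(186)'s floor + (191)'s Schur test on `T_K − T`; (233) on `(T_K, N_K)`. [folklore] -/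
theorem zd_perturbed_coarse_form (hd : 3 ≤ d) (a : ℝ) (ha : 0 < a) {lam Lam : ℝ} (hlam : lam < min 2 a) (hLam : 0 ≤ Lam) :
    ∃ C₀ CP δ₀ c₁ δ₁ ΛT : ℝ, 0 < C₀ ∧ 0 < CP ∧ 0 < δ₀ ∧ 0 < c₁ ∧ 0 < δ₁ ∧ 0 < ΛT ∧
    ∀ (n : ℕ) (V : X d → ℝ), (∀ p, -lam ≤ V p) → (∀ p, V p ≤ Lam) →
    ∀ (ε γ μ ν : ℝ), 0 ≤ ε → 0 < μ → μ < δ₀ → μ < γ → 0 < ν → ν < μ → ν < δ₁ →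
      ε * (2 * (1 - exp (-γ))⁻¹) ^ d * C₀ ≤ 1 / 2 →
      (CP * (2 * (1 - exp (-(δ₀ - μ)))⁻¹) ^ d) * (ε * exp (μ * d) * (2 * (1 - exp (-(γ - μ)))⁻¹) ^ d) ≤ 1 / 2 →
      (c₁ * exp (ν * d) * (2 * (1 - exp (-(δ₁ - ν)))⁻¹) ^ d)
        * ((4 * (CP * (2 * (1 - exp (-(δ₀ - μ)))⁻¹) ^ d)
            * ((CP * (2 * (1 - exp (-(δ₀ - μ)))⁻¹) ^ d) * (ε * exp (μ * d) * (2 * (1 - exp (-(γ - μ)))⁻¹) ^ d)))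
          * exp (ν * d) * (2 * (1 - exp (-(μ - ν)))⁻¹) ^ d) ≤ 1 / 2 →
      (4 * (CP * (2 * (1 - exp (-(δ₀ - μ)))⁻¹) ^ d)
          * ((CP * (2 * (1 - exp (-(δ₀ - μ)))⁻¹) ^ d) * (ε * exp (μ * d) * (2 * (1 - exp (-(γ - μ)))⁻¹) ^ d)))
        * (2 * (1 - exp (-μ))⁻¹) ^ d ≤ 1 / ((36 : ℝ) ^ d * (4 * d + a + Lam)) / 2 →
    ∀ (K : X d → X d → ℝ), (∀ p q, |K p q| ≤ ε * exp (-(γ * ∑ i, (((p i - q i).natAbs : ℕ) : ℝ)))) →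
      (∀ p q, K p q = K q p) →
    ∃ Ψ ΨK M N : X d → X d → ℝ,
      -- (A) the block columns
      (∀ c p, ((n : ℝ) + 1) ^ 2 * ∑ μ', (2 * Ψ c p - Ψ c (p + e μ') - Ψ c (p - e μ'))
        + a / ((n : ℝ) + 1) ^ d * ∑ q ∈ B n (blk n p), Ψ c q + V p * Ψ c p = if blk n p = c then 1 else 0) ∧
      (∀ c p, |Ψ c p| ≤ 2 * (CP * (2 * (1 - exp (-(δ₀ - μ)))⁻¹) ^ d) * exp (-(μ * ∑ i, (((blk n p i - c i).natAbs : ℕ) : ℝ)))) ∧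
      (∀ c p, ((n : ℝ) + 1) ^ 2 * ∑ μ', (2 * ΨK c p - ΨK c (p + e μ') - ΨK c (p - e μ'))
        + a / ((n : ℝ) + 1) ^ d * ∑ q ∈ B n (blk n p), ΨK c q + V p * ΨK c p + ∑' q : X d, K p q * ΨK c q
          = if blk n p = c then 1 else 0) ∧
      (∀ c p, |ΨK c p| ≤ 2 * (CP * (2 * (1 - exp (-(δ₀ - μ)))⁻¹) ^ d) * exp (-(μ * ∑ i, (((blk n p i - c i).natAbs : ℕ) : ℝ)))) ∧
      (∀ c p, |ΨK c p - Ψ c p| ≤ 4 * (CP * (2 * (1 - exp (-(δ₀ - μ)))⁻¹) ^ d)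
        * ((CP * (2 * (1 - exp (-(δ₀ - μ)))⁻¹) ^ d) * (ε * exp (μ * d) * (2 * (1 - exp (-(γ - μ)))⁻¹) ^ d))
        * exp (-(μ * ∑ i, (((blk n p i - c i).natAbs : ℕ) : ℝ)))) ∧
      (∀ b c, |(((n : ℝ) + 1) ^ d)⁻¹ * ∑ q ∈ B n b, ΨK c q - (((n : ℝ) + 1) ^ d)⁻¹ * ∑ q ∈ B n b, Ψ c q|
        ≤ 4 * (CP * (2 * (1 - exp (-(δ₀ - μ)))⁻¹) ^ d)
          * ((CP * (2 * (1 - exp (-(δ₀ - μ)))⁻¹) ^ d) * (ε * exp (μ * d) * (2 * (1 - exp (-(γ - μ)))⁻¹) ^ d))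
          * exp (-(μ * ∑ i, (((b i - c i).natAbs : ℕ) : ℝ)))) ∧
      -- (B) the inverse of the coarse operator
      (∀ b b' : X d, Tendsto (fun R : ℕ =>
        if h : b ∈ (Fintype.piFinset fun _ : Fin d => Finset.Icc (-(R : ℤ)) R) ∧
            b' ∈ (Fintype.piFinset fun _ : Fin d => Finset.Icc (-(R : ℤ)) R)
          then (Matrix.of fun c c' : ↥(Fintype.piFinset fun _ : Fin d => Finset.Icc (-(R : ℤ)) R) =>
            (((n : ℝ) + 1) ^ d)⁻¹ * ∑ q ∈ B n (c : X d), Ψ (c' : X d) q)⁻¹ ⟨b, h.1⟩ ⟨b', h.2⟩ else 0)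
        atTop (𝓝 (M b b'))) ∧
      (∀ b c, |M b c| ≤ c₁ * exp (-(δ₁ * ∑ i, (((b i - c i).natAbs : ℕ) : ℝ)))) ∧
      (∀ b c, M b c = M c b) ∧
      (∀ b c, ∑' b' : X d, ((((n : ℝ) + 1) ^ d)⁻¹ * ∑ q ∈ B n b, Ψ b' q) * M b' c = if b = c then 1 else 0) ∧
      (∀ b c, ∑' b' : X d, M b b' * ((((n : ℝ) + 1) ^ d)⁻¹ * ∑ q ∈ B n b', Ψ c q) = if b = c then 1 else 0) ∧
      -- (C) the inverse of the perturbed coarse operator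
      (∀ b c, |N b c| ≤ 2 * (c₁ * exp (ν * d) * (2 * (1 - exp (-(δ₁ - ν)))⁻¹) ^ d) * exp (-(ν * ∑ i, (((b i - c i).natAbs : ℕ) : ℝ)))) ∧
      (∀ b c, Summable (fun b' : X d => ((((n : ℝ) + 1) ^ d)⁻¹ * ∑ q ∈ B n b, ΨK b' q) * N b' c) ∧
        ∑' b' : X d, ((((n : ℝ) + 1) ^ d)⁻¹ * ∑ q ∈ B n b, ΨK b' q) * N b' c = if b = c then 1 else 0) ∧
      (∀ b c, Summable (fun b' : X d => N b b' * ((((n : ℝ) + 1) ^ d)⁻¹ * ∑ q ∈ B n b', ΨK c q)) ∧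
        ∑' b' : X d, N b b' * ((((n : ℝ) + 1) ^ d)⁻¹ * ∑ q ∈ B n b', ΨK c q) = if b = c then 1 else 0) ∧
      (∀ b c, |N b c - M b c| ≤ 2 * (c₁ * exp (ν * d) * (2 * (1 - exp (-(δ₁ - ν)))⁻¹) ^ d)
        * ((c₁ * exp (ν * d) * (2 * (1 - exp (-(δ₁ - ν)))⁻¹) ^ d)
          * ((4 * (CP * (2 * (1 - exp (-(δ₀ - μ)))⁻¹) ^ d)
              * ((CP * (2 * (1 - exp (-(δ₀ - μ)))⁻¹) ^ d) * (ε * exp (μ * d) * (2 * (1 - exp (-(γ - μ)))⁻¹) ^ d)))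
            * exp (ν * d) * (2 * (1 - exp (-(μ - ν)))⁻¹) ^ d))
        * exp (-(ν * ∑ i, (((b i - c i).natAbs : ℕ) : ℝ)))) ∧
      (∀ (N' : X d → X d → ℝ) (C' ν' : ℝ), 0 ≤ C' → 0 < ν' →
        (∀ b c, |N' b c| ≤ C' * exp (-(ν' * ∑ i, (((b i - c i).natAbs : ℕ) : ℝ)))) →
        ((∀ b c, ∑' b' : X d, ((((n : ℝ) + 1) ^ d)⁻¹ * ∑ q ∈ B n b, ΨK b' q) * N' b' c = if b = c then 1 else 0) →
          ∀ b c, N' b c = N b c) ∧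
        ((∀ b c, ∑' b' : X d, N' b b' * ((((n : ℝ) + 1) ^ d)⁻¹ * ∑ q ∈ B n b', ΨK c q) = if b = c then 1 else 0) →
          ∀ b c, N' b c = N b c)) ∧
      -- (D) SYMMETRY for a symmetric `K`: the perturbed coarse operator and its inverse are symmetric kernels
      (∀ b c, (((n : ℝ) + 1) ^ d)⁻¹ * ∑ q ∈ B n b, ΨK c q = (((n : ℝ) + 1) ^ d)⁻¹ * ∑ q ∈ B n c, ΨK b q) ∧
      (∀ b c, N b c = N c b) ∧
      -- (E) THE `ℓ²` COLUMN: entry decay, floor and form bound of `T_K` on finite supports; the form of `N_K = T_K⁻¹`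
      (∀ b c, |(((n : ℝ) + 1) ^ d)⁻¹ * ∑ q ∈ B n b, ΨK c q|
        ≤ 2 * (CP * (2 * (1 - exp (-(δ₀ - μ)))⁻¹) ^ d) * exp (-(μ * ∑ i, (((b i - c i).natAbs : ℕ) : ℝ)))) ∧
      (∀ (S : Finset (X d)) (g : X d → ℝ), (∀ b, b ∉ S → g b = 0) →
        1 / ((36 : ℝ) ^ d * (4 * d + a + Lam)) / 2 * ∑ b ∈ S, g b ^ 2
          ≤ ∑ b ∈ S, g b * ∑ c ∈ S, ((((n : ℝ) + 1) ^ d)⁻¹ * ∑ q ∈ B n b, ΨK c q) * g c) ∧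
      (∀ (S : Finset (X d)) (g h : X d → ℝ),
        (∑ b ∈ S, h b * ∑ c ∈ S, ((((n : ℝ) + 1) ^ d)⁻¹ * ∑ q ∈ B n b, ΨK c q) * g c) ^ 2
          ≤ (ΛT + 1 / ((36 : ℝ) ^ d * (4 * d + a + Lam)) / 2) ^ 2 * (∑ b ∈ S, h b ^ 2) * ∑ c ∈ S, g c ^ 2) ∧
      (∀ (S : Finset (X d)) (k : X d → ℝ), (∀ b, b ∉ S → k b = 0) →
        (∀ b, ∑' c : X d, ((((n : ℝ) + 1) ^ d)⁻¹ * ∑ q ∈ B n b, ΨK c q) * ∑ c' ∈ S, N c c' * k c' = k b) ∧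
        Summable (fun b => (∑ c ∈ S, N b c * k c) ^ 2) ∧
        (∀ F : Finset (X d), ∑ b ∈ F, (∑ c ∈ S, N b c * k c) ^ 2 ≤ ∑' b, (∑ c ∈ S, N b c * k c) ^ 2) ∧
        (∑' b, (∑ c ∈ S, N b c * k c) ^ 2 ≤ (1 / (1 / ((36 : ℝ) ^ d * (4 * d + a + Lam)) / 2)) ^ 2 * ∑ b ∈ S, k b ^ 2) ∧
        (1 / ((36 : ℝ) ^ d * (4 * d + a + Lam)) / 2 * ∑' b, (∑ c ∈ S, N b c * k c) ^ 2 ≤ ∑ b ∈ S, k b * ∑ c ∈ S, N b c * k c) ∧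
        (∑ b ∈ S, k b * ∑ c ∈ S, N b c * k c ≤ 1 / (1 / ((36 : ℝ) ^ d * (4 * d + a + Lam)) / 2) * ∑ b ∈ S, k b ^ 2) ∧
        (1 / ((36 : ℝ) ^ d * (4 * d + a + Lam)) / 2 / (ΛT + 1 / ((36 : ℝ) ^ d * (4 * d + a + Lam)) / 2) ^ 2 * ∑ b ∈ S, k b ^ 2
          ≤ ∑ b ∈ S, k b * ∑ c ∈ S, N b c * k c)) := by
  classical
  obtain ⟨C₀, CP, δ₀, c₁, δ₁, hC₀, hCP, hδ₀, hc₁, hδ₁, H232⟩ := zd_perturbed_symmetric (d := d) hd a ha hlam hLam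
  obtain ⟨ΛT, hΛT, H191⟩ := zd_coarse_form_bounded (d := d) hd a ha hlam hLam
  refine ⟨C₀, CP, δ₀, c₁, δ₁, ΛT, hC₀, hCP, hδ₀, hc₁, hδ₁, hΛT, ?_⟩
  intro n V hV hV' ε γ μ ν hε hμ hμδ hμγ hν hνμ hνδ hsmall1 hsmall2 hsmall3 hsmall4 K hK hKs
  obtain ⟨Ψ, ΨK, M, N, hA1, hA2, hA3, hA4, hA5, hA6, hB1, hB2, hB3, hB4, hB5, hC1, hC2, hC3, hC4, hC5, hD1, hD2⟩ :=
    H232 n V hV hV' ε γ μ ν hε hμ hμδ hμγ hν hνμ hνδ hsmall1 hsmall2 hsmall3 K hK hKs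
  refine ⟨Ψ, ΨK, M, N, hA1, hA2, hA3, hA4, hA5, hA6, hB1, hB2, hB3, hB4, hB5, hC1, hC2, hC3, hC4, hC5, hD1, hD2, ?_⟩
  -- the letters
  have hγQ : (0 : ℝ) < 1 / ((36 : ℝ) ^ d * (4 * d + a + Lam)) := by positivity
  have hK0 : 0 < (2 * (1 - exp (-(δ₀ - μ)))⁻¹) ^ d := K_pos (d := d) (sub_pos.2 hμδ)
  have hKμ : 0 < (2 * (1 - exp (-μ))⁻¹) ^ d := K_pos (d := d) hμ
  have hK1 : 0 < (2 * (1 - exp (-(γ - μ)))⁻¹) ^ d := K_pos (d := d) (sub_pos.2 hμγ)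
  have hK2 : 0 < (2 * (1 - exp (-(δ₁ - ν)))⁻¹) ^ d := K_pos (d := d) (sub_pos.2 hνδ)
  obtain ⟨DE, hDE⟩ : ∃ DE : ℝ, DE = 4 * (CP * (2 * (1 - exp (-(δ₀ - μ)))⁻¹) ^ d)
      * ((CP * (2 * (1 - exp (-(δ₀ - μ)))⁻¹) ^ d) * (ε * exp (μ * d) * (2 * (1 - exp (-(γ - μ)))⁻¹) ^ d)) := ⟨_, rfl⟩
  have hDE0 : 0 ≤ DE := by rw [hDE]; positivity
  rw [← hDE] at hsmall4
  have hDEle : DE * (2 * (1 - exp (-μ))⁻¹) ^ d ≤ 1 / ((36 : ℝ) ^ d * (4 * d + a + Lam)) / 2 := hsmall4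
  -- the kernels `T`, `T_K` as opaque letters
  obtain ⟨T, hT⟩ : ∃ T : X d → X d → ℝ, ∀ b c, T b c = (((n : ℝ) + 1) ^ d)⁻¹ * ∑ q ∈ B n b, Ψ c q := ⟨_, fun _ _ => rfl⟩
  obtain ⟨TK, hTK⟩ : ∃ TK : X d → X d → ℝ, ∀ b c, TK b c = (((n : ℝ) + 1) ^ d)⁻¹ * ∑ q ∈ B n b, ΨK c q := ⟨_, fun _ _ => rfl⟩
  have hΨb : ∀ c p, |Ψ c p| ≤ 2 * (CP * (2 * (1 - exp (-(δ₀ - μ)))⁻¹) ^ d) := fun c p =>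
    (hA2 c p).trans (mul_le_of_le_one_right (by positivity) (exp_le_one_iff.2 (by rw [neg_nonpos]; positivity)))
  have hTKd : ∀ b c, |TK b c| ≤ 2 * (CP * (2 * (1 - exp (-(δ₀ - μ)))⁻¹) ^ d) * exp (-(μ * ∑ i, (((b i - c i).natAbs : ℕ) : ℝ))) :=
    fun b c => by rw [hTK]; exact coarse_entry_le n ΨK c (hA4 c) b
  have hEd : ∀ b c, |TK b c - T b c| ≤ DE * exp (-(μ * ∑ i, (((b i - c i).natAbs : ℕ) : ℝ))) := fun b c => by
    rw [hTK, hT, hDE]; exact hA6 b c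
  have hsplit : ∀ (S : Finset (X d)) (g h : X d → ℝ), ∑ b ∈ S, h b * ∑ c ∈ S, TK b c * g c
      = ∑ b ∈ S, h b * ∑ c ∈ S, T b c * g c + ∑ b ∈ S, h b * ∑ c ∈ S, (TK b c - T b c) * g c := fun S g h => by
    rw [← Finset.sum_add_distrib]
    refine Finset.sum_congr rfl fun b _ => ?_
    rw [← mul_add, ← Finset.sum_add_distrib]
    exact congrArg _ (Finset.sum_congr rfl fun c _ => by ring)
  -- (E1) the floor of `T_K`
  have hE1 : ∀ (S : Finset (X d)) (g : X d → ℝ), (∀ b, b ∉ S → g b = 0) →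
      1 / ((36 : ℝ) ^ d * (4 * d + a + Lam)) / 2 * ∑ b ∈ S, g b ^ 2 ≤ ∑ b ∈ S, g b * ∑ c ∈ S, TK b c * g c := by
    intro S g hg
    have h186 := zd_coarse_floor hd a ha hlam hLam n V hV hV' Ψ (fun _ => 2 * (CP * (2 * (1 - exp (-(δ₀ - μ)))⁻¹) ^ d)) hΨb hA1 S g hg
    simp only [← hT] at h186
    have hS0 : 0 ≤ ∑ b ∈ S, g b ^ 2 := Finset.sum_nonneg fun _ _ => sq_nonneg _
    have hE := kernel_form_sq_le hμ (fun b c => TK b c - T b c) hEd S g g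
    have hEabs : |∑ b ∈ S, g b * ∑ c ∈ S, (TK b c - T b c) * g c| ≤ DE * (2 * (1 - exp (-μ))⁻¹) ^ d * ∑ b ∈ S, g b ^ 2 :=
      abs_le_of_sq_le_sq (hE.trans (le_of_eq (by ring))) (by positivity)
    have hEle : DE * (2 * (1 - exp (-μ))⁻¹) ^ d * ∑ b ∈ S, g b ^ 2 ≤ 1 / ((36 : ℝ) ^ d * (4 * d + a + Lam)) / 2 * ∑ b ∈ S, g b ^ 2 :=
      mul_le_mul_of_nonneg_right hDEle hS0
    rw [hsplit S g g]
    linarith [neg_abs_le (∑ b ∈ S, g b * ∑ c ∈ S, (TK b c - T b c) * g c)]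
  -- (E2) the form bound of `T_K`
  have hE2 : ∀ (S : Finset (X d)) (g h : X d → ℝ),
      (∑ b ∈ S, h b * ∑ c ∈ S, TK b c * g c) ^ 2 ≤ (ΛT + 1 / ((36 : ℝ) ^ d * (4 * d + a + Lam)) / 2) ^ 2 * (∑ b ∈ S, h b ^ 2) * ∑ c ∈ S, g c ^ 2 := by
    intro S g h
    have h191 := (H191 n V hV hV' Ψ (fun _ => 2 * (CP * (2 * (1 - exp (-(δ₀ - μ)))⁻¹) ^ d)) hΨb hA1 S g h).1
    simp only [← hT] at h191
    have hE := kernel_form_sq_le hμ (fun b c => TK b c - T b c) hEd S g h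
    have hc : 0 ≤ (∑ b ∈ S, h b ^ 2) * ∑ c ∈ S, g c ^ 2 :=
      mul_nonneg (Finset.sum_nonneg fun _ _ => sq_nonneg _) (Finset.sum_nonneg fun _ _ => sq_nonneg _)
    have h1 := sq_add_le hΛT.le (by positivity : 0 ≤ DE * (2 * (1 - exp (-μ))⁻¹) ^ d) hc
      (by rw [← mul_assoc]; exact h191) (by rw [← mul_assoc]; exact hE)
    rw [hsplit S g h, mul_assoc]
    refine h1.trans (mul_le_mul_of_nonneg_right (pow_le_pow_left₀ (by positivity) (by linarith) 2) hc)
  -- (E3) the form of `N_K` by (233)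
  have hC2' : ∀ b c, ∑' b' : X d, TK b b' * N b' c = if b = c then 1 else 0 := fun b c => by
    simp only [hTK]; exact (hC2 b c).2
  have hE3 := fun (S : Finset (X d)) (k : X d → ℝ) (hk : ∀ b, b ∉ S → k b = 0) =>
    decaying_inverse_form (d := d) hμ (half_pos hγQ) (by positivity : 0 < ΛT + 1 / ((36 : ℝ) ^ d * (4 * d + a + Lam)) / 2)
      (by positivity : (0 : ℝ) ≤ 2 * (c₁ * exp (ν * d) * (2 * (1 - exp (-(δ₁ - ν)))⁻¹) ^ d)) hν TK N hTKd hE1 hE2 hC1 hC2' S k hk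
  simp only [hTK] at hTKd hE1 hE2 hE3
  exact ⟨hTKd, hE1, hE2, hE3⟩

/-! ## §3. Toy -/

/-- Toy (`d = 3`, `a = 1`, `λ = 0`, `Λ = 1`): the six constants exist. -/
example : ∃ C₀ CP δ₀ c₁ δ₁ ΛT : ℝ, 0 < C₀ ∧ 0 < CP ∧ 0 < δ₀ ∧ 0 < c₁ ∧ 0 < δ₁ ∧ 0 < ΛT :=
  let ⟨C₀, CP, δ₀, c₁, δ₁, ΛT, h1, h2, h3, h4, h5, h6, _⟩ :=
    zd_perturbed_coarse_form (d := 3) le_rfl 1 one_pos (lam := 0) (Lam := 1)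
      (by rw [min_eq_right (by norm_num : (1 : ℝ) ≤ 2)]; norm_num) zero_le_one
  ⟨C₀, CP, δ₀, c₁, δ₁, ΛT, h1, h2, h3, h4, h5, h6⟩

end Summit.QuantumFields.BalabanUV.T4Continuum.NE7b.SupZdPerturbedCoarseForm
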